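import Mathlib.Analysis.Calculus.ImplicitContDiff
import Summits.QuantumFields.BalabanUV.T4Continuum.Support.SubstrateComplexBackground

/-!
# NE9ComplexBackgroundOfImplicit — THE KERNEL MECHANISM BEHIND THE (H∃) ROW OF SPECIES (a): a HOLOMORPHIC criticality map,
# NON-DEGENERATE at the real background of record, yields an inhabitant of the substrate's D-8 (v) interface
# `SubstrateComplexBackground.ComplexBackgroundFamily` THROUGH that background, characterised as the zero family near the centre
# (complex-analytic implicit function theorem, Mathlib `ContDiffAt.implicitFunction` at `n = ω` over `ℂ`), together with the
# REAL-SLICE TIE (any continuous family of zeros through the centre IS this family near the centre)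
# (cell `pub-balaban`, T4-DAG §2 node U3 ∕ §6 NE9; BINDER row NE9 OWNER lineage `b2b-balaban-t4-ne9-p1`, generation 54;
# WALL-NE9-P1 §2 row S5 (a) ∕ §3 (vii) «the species' analytic fields are an (H∃)-class T-row»; nothing of any import modified)

HONEST FRAMING (T4-DAG PAGE 1).  Rung (B)+1 of the FINITE-VOLUME T⁴ programme — NOT infinite volume, NOT a mass gap, NOT the
Clay problem.  NE9 (`T4OutputRate.NE9` ∧ `FadingMemory`) is a cell NEW ESTIMATE, NOT PRINTED in [I] = [Balaban1987RG1]
(CMP **109**), [II] = [Balaban1988RG2Cluster] (CMP **116**), and NOT PROVED for Bałaban's E^{(j)} («NE9 ⇐ the named binders»;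
spine PROVED 0∕9).  HONEST DEPENDENCY (cell line, verbatim): continuum YM on T⁴ ⇐ BetaPertH ∧ nine spine estimates (0/9 proved);
BetaPertH ⇐ (D1) ∧ (D4) ∧ CAP+tail; G-an2-4 gates asym, D1 and NE2/3/4.  `FlowStep.BetaPertH`, (B), (B^μ) do not occur.
MECHANISM ONLY: NOTHING here constructs Bałaban's background field, the holomorphic action, or its criticality map; the hypotheses
of §3 are exactly what the MODEL (O-NE9-1 ∕ socket C19′: B11 on lattice objects) must supply — a criticality map `g` holomorphic near
`(0, R0)` and NON-DEGENERATE there in the unknown — and the printed TYPE statements behind them stay displayed wherever the END displays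
them: [Balaban1985Variational] (B11) Thm 1 p. 279 (unique critical orbit), Sect. C–G (positivity of the Hessian on the constrained,
gauge-fixed subspace); [I] Lemma 4 (3.53) p. 280 (the QUANTITATIVE clauses — radius `ϱ`, range in `𝔘^c_j(X, α₀, α₁)` — are NOT
touched: the implicit function theorem controls no radius).  [B9] Sect. B pp. 399–400 is the printed warrant for reading backgrounds on
complexified configurations.  ABSOLUTE RULE: nothing printed is asserted; 0 sorry.

WHAT.
* §1 (generic, complex Banach spaces `Ξ, E, F`) **`exists_analytic_implicit`**: `g : Ξ × E → F` of class `C^ω` at `(ξ₀, x₀)` with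
  `∂₂g(ξ₀, x₀)` invertible ⇒ a germ `x : Ξ → E`, `x ξ₀ = x₀`, ANALYTIC at `ξ₀`, with `g (ξ, x ξ) = g (ξ₀, x₀)` near `ξ₀` and the
  UNIQUENESS clause `g q = g (ξ₀, x₀) ↔ x q.1 = q.2` near `(ξ₀, x₀)`; **`exists_ball_holomorphic_implicit`**: the same on a BALL
  (`DifferentiableOn ℂ x (ball ξ₀ ρ)`, zeros on the ball); **`eventuallyEq_of_zero_family`**: the real-slice tie — a family `y`
  CONTINUOUS at `ξ₀` with `y ξ₀ = x₀` and `g (ξ, y ξ) = g (ξ₀, x₀)` near `ξ₀` agrees with `x` near `ξ₀`.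
* §2 `eventually_isUnit_det_family`: along a family of tower data continuous at the centre, pointwise invertibility of the centre
  persists on a ball (finitely many levels ∕ directions ∕ bonds).
* §3 **`exists_complexBackgroundFamily_of_implicit`**: for tower data `R0` invertible bond by bond (e.g. unitary-valued, the record's)
  and a criticality map `g : Ξ × TowerData P o → F`, `C^ω` at `(0, R0)` with `∂₂g(0, R0)` invertible: `∃ ρ > 0` and
  `Fm : ComplexBackgroundFamily P Ξ R0 ρ` (built by `ofInvertible`) with `g (ξ, Fm.uC ξ) = g (0, R0)` on `ball 0 ρ` and the uniqueness
  clause near `(0, R0)`; **`uC_eventuallyEq_of_zero_family`**: any continuous zero family through `R0` IS `Fm.uC` near `0`.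
DICTIONARY (WALL-NE9-P1 §2 row S5 (a)): the (H∃) hypothesis «a complex background family through the real background exists» splits into
(H∃-qual) = THIS MECHANISM (K) ⇐ {`g` holomorphic — MODEL; `∂₂g(0, R0)` invertible — T, B11} and (H-quant) = [I] Lemma 4 (3.53) (T).
DISGUISE TEST: Mathlib's implicit function theorem + continuity of determinants; no inequality of the series; not NE9.

References (TYPES ∕ loci only): [Balaban1987RG1] T. Bałaban, CMP **109** (1987) 249–301, (1.18) p. 263, Lemma 4 (3.53) p. 280;
[Balaban1985Variational] T. Bałaban, CMP **102** (1985) 277–309, Thm 1 p. 279; [Balaban1985BackgroundPropagators] T. Bałaban, CMP **99**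
(1985) 389–434, Sect. B pp. 399–400.  Summits-side NEW work (LEAN PLACEMENT RULE); imports `SubstrateComplexBackground` (p222080) and
Mathlib's `ImplicitContDiff` ONLY; modifies nothing.  Value = the kernel mechanism of one T-row's existence clause, NOT summit progress.
-/

noncomputable section

open scoped Topology ContDiff Matrix Matrix.Norms.L2Operator
open Metric Set Filter

namespace Summit.QuantumFields.BalabanUV.T4Continuum.NE9ComplexBackgroundOfImplicit

open Literature.MathematicalPhysics.QuantumFieldTheory.Balaban1983to89
open Literature.MathematicalPhysics.QuantumFieldTheory.Balaban1983to89.B5Prop11Plancherel (Tor fine)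
open Literature.MathematicalPhysics.QuantumFieldTheory.Balaban1983to89.B5G183RateUnitTower (lev)
open Summit.QuantumFields.BalabanUV.T4Continuum.SubstrateBackgroundTransporters (unitMod)
open Summit.QuantumFields.BalabanUV.T4Continuum.SubstrateTransporterSpecies (TowerData)
open Summit.QuantumFields.BalabanUV.T4Continuum.SubstrateComplexBackground (ComplexBackgroundFamily)

/-! ## §1 The complex-analytic implicit function, in the shape the interface wants -/

section Generic

variable {Ξ : Type*} [NormedAddCommGroup Ξ] [NormedSpace ℂ Ξ] [CompleteSpace Ξ]
  {E : Type*} [NormedAddCommGroup E] [NormedSpace ℂ E] [CompleteSpace E]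
  {F : Type*} [NormedAddCommGroup F] [NormedSpace ℂ F] [CompleteSpace F]

/-- [folklore] **THE ANALYTIC IMPLICIT GERM.**  For `g : Ξ × E → F` of class `C^ω` (over `ℂ`) at `(ξ₀, x₀)` whose partial derivative in
the unknown `∂₂g(ξ₀, x₀)` is invertible there is `x : Ξ → E` with `x ξ₀ = x₀`, analytic at `ξ₀`, solving `g (ξ, x ξ) = g (ξ₀, x₀)` near
`ξ₀`, and UNIQUE: near `(ξ₀, x₀)`, `g q = g (ξ₀, x₀) ↔ x q.1 = q.2` (Mathlib `ContDiffAt.implicitFunction` at `n = ω`). -/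
theorem exists_analytic_implicit {g : Ξ × E → F} {ξ₀ : Ξ} {x₀ : E} (hg : ContDiffAt ℂ ω g (ξ₀, x₀))
    (hinv : (fderiv ℂ g (ξ₀, x₀) ∘L ContinuousLinearMap.inr ℂ Ξ E).IsInvertible) :
    ∃ x : Ξ → E, x ξ₀ = x₀ ∧ AnalyticAt ℂ x ξ₀ ∧ (∀ᶠ ξ in 𝓝 ξ₀, g (ξ, x ξ) = g (ξ₀, x₀)) ∧
      ∀ᶠ q in 𝓝 (ξ₀, x₀), g q = g (ξ₀, x₀) ↔ x q.1 = q.2 := by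
  have hω : (ω : ℕ∞ω) ≠ 0 := by simp
  set x : Ξ → E := hg.implicitFunction hω hinv with hxdef
  have hx0 : x ξ₀ = x₀ := hg.implicitFunction_apply_self hω hinv
  have han : AnalyticAt ℂ x ξ₀ := (hg.contDiffAt_implicitFunction hω hinv).analyticAt
  have huniq : ∀ᶠ q in 𝓝 (ξ₀, x₀), g q = g (ξ₀, x₀) ↔ x q.1 = q.2 :=
    hg.eventually_apply_eq_iff_implicitFunction hω hinv
  have hcont : ContinuousAt (fun ξ => (ξ, x ξ)) ξ₀ := continuousAt_id.prodMk han.continuousAt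
  have hzero : ∀ᶠ ξ in 𝓝 ξ₀, g (ξ, x ξ) = g (ξ₀, x₀) := by
    have h := hcont.tendsto
    rw [hx0] at h
    filter_upwards [h.eventually huniq] with ξ hξ
    exact hξ.2 rfl
  exact ⟨x, hx0, han, hzero, huniq⟩

/-- [folklore] **THE HOLOMORPHIC IMPLICIT FAMILY ON A BALL**: as `exists_analytic_implicit`, with the germ complex-differentiable on a
ball `ball ξ₀ ρ`, `ρ > 0`, and the equation solved on that ball (the radius is NOT controlled). -/
theorem exists_ball_holomorphic_implicit {g : Ξ × E → F} {ξ₀ : Ξ} {x₀ : E} (hg : ContDiffAt ℂ ω g (ξ₀, x₀))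
    (hinv : (fderiv ℂ g (ξ₀, x₀) ∘L ContinuousLinearMap.inr ℂ Ξ E).IsInvertible) :
    ∃ x : Ξ → E, x ξ₀ = x₀ ∧ ContinuousAt x ξ₀ ∧ (∀ᶠ q in 𝓝 (ξ₀, x₀), g q = g (ξ₀, x₀) ↔ x q.1 = q.2) ∧
      ∃ ρ > 0, DifferentiableOn ℂ x (ball ξ₀ ρ) ∧ ∀ ξ ∈ ball ξ₀ ρ, g (ξ, x ξ) = g (ξ₀, x₀) := by
  obtain ⟨x, hx0, han, hzero, huniq⟩ := exists_analytic_implicit hg hinv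
  obtain ⟨r₁, hr₁, han₁⟩ := han.exists_ball_analyticOnNhd
  obtain ⟨r₂, hr₂, hz₂⟩ := Metric.eventually_nhds_iff_ball.1 hzero
  refine ⟨x, hx0, han.continuousAt, huniq, min r₁ r₂, lt_min hr₁ hr₂, ?_, fun ξ hξ => hz₂ ξ ?_⟩
  · exact han₁.differentiableOn.mono (Metric.ball_subset_ball (min_le_left _ _))
  · exact Metric.ball_subset_ball (min_le_right _ _) hξ

omit [NormedSpace ℂ Ξ] [CompleteSpace Ξ] [NormedSpace ℂ E] [CompleteSpace E] [NormedAddCommGroup F] [NormedSpace ℂ F] [CompleteSpace F] in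
/-- [folklore] **THE REAL-SLICE TIE (uniqueness)**: a family `y` CONTINUOUS at `ξ₀` through `x₀` solving the equation near `ξ₀`
agrees near `ξ₀` with any family `x` having the uniqueness clause (in use: the real backgrounds along a real slice parameter
versus the holomorphic family). -/
theorem eventuallyEq_of_zero_family {g : Ξ × E → F} {ξ₀ : Ξ} {x₀ : E} {x y : Ξ → E}
    (huniq : ∀ᶠ q in 𝓝 (ξ₀, x₀), g q = g (ξ₀, x₀) ↔ x q.1 = q.2) (hyc : ContinuousAt y ξ₀) (hy0 : y ξ₀ = x₀)
    (hyz : ∀ᶠ ξ in 𝓝 ξ₀, g (ξ, y ξ) = g (ξ₀, x₀)) : y =ᶠ[𝓝 ξ₀] x := by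
  have hcont : ContinuousAt (fun ξ => (ξ, y ξ)) ξ₀ := continuousAt_id.prodMk hyc
  have h := hcont.tendsto
  rw [hy0] at h
  filter_upwards [h.eventually huniq, hyz] with ξ hξ hz
  exact ((hξ.1 hz).symm : y ξ = x ξ)

end Generic

/-! ## §2 Invertibility persists along a continuous family of tower data -/

variable (P : Params) {o : Type*} [Fintype o] [DecidableEq o]
variable {Ξ : Type*} [NormedAddCommGroup Ξ] [NormedSpace ℂ Ξ]

omit [NormedSpace ℂ Ξ] in
/-- [folklore] Along a family of tower data continuous at `0` whose centre is invertible bond by bond, every bond matrix stays invertible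
on some ball around `0` (finitely many levels, directions and bonds; continuity of the determinant). -/
theorem eventually_isUnit_det_family {R0 : TowerData P o} {x : Ξ → TowerData P o} (hxc : ContinuousAt x 0) (hx0 : x 0 = R0)
    (hR0 : ∀ (k : Fin (P.K + 1)) ν b, IsUnit (R0 k ν b).det) :
    ∃ ρ > 0, ∀ ξ ∈ ball (0 : Ξ) ρ, ∀ (k : Fin (P.K + 1)) ν b, IsUnit (x ξ k ν b).det := by
  have hev : ∀ (k : Fin (P.K + 1)) (ν : Fin P.d) (b : Tor (fine (lev P.L k) (unitMod P)) × Fin P.d),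
      ∀ᶠ ξ in 𝓝 (0 : Ξ), IsUnit (x ξ k ν b).det := by
    intro k ν b
    have hπ : Continuous fun T : TowerData P o => T k ν b :=
      (continuous_apply b).comp ((continuous_apply ν).comp (continuous_apply k))
    have hc' : ContinuousAt (fun ξ => x ξ k ν b) 0 := hπ.continuousAt.comp hxc
    have hc : ContinuousAt (fun ξ => (x ξ k ν b).det) 0 :=
      (continuous_id.matrix_det : Continuous fun A : Matrix o o ℂ => A.det).continuousAt.comp hc'
    have hne : (x 0 k ν b).det ≠ 0 := by rw [hx0]; exact (hR0 k ν b).ne_zero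
    simpa only [isUnit_iff_ne_zero] using hc.eventually_ne hne
  have hall : ∀ᶠ ξ in 𝓝 (0 : Ξ), ∀ (k : Fin (P.K + 1)) ν b, IsUnit (x ξ k ν b).det := by
    simp only [Filter.eventually_all]
    exact hev
  obtain ⟨ρ, hρ, h⟩ := Metric.eventually_nhds_iff_ball.1 hall
  exact ⟨ρ, hρ, h⟩

/-! ## §3 The complex background family of an implicit (criticality) equation -/

variable [CompleteSpace Ξ] {F : Type*} [NormedAddCommGroup F] [NormedSpace ℂ F] [CompleteSpace F]

/-- **A HOLOMORPHIC, NON-DEGENERATE CRITICALITY MAP GIVES A COMPLEX BACKGROUND FAMILY THROUGH THE REAL BACKGROUND.**  Let `R0` be tower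
data invertible bond by bond (the record's is unitary-valued) and `g : Ξ × TowerData P o → F` (in use: the fibre derivative of the
holomorphic reduced action, O-NE9-1 ∕ C19′) be `C^ω` over `ℂ` at `(0, R0)` with `∂₂g(0, R0)` invertible (in use: B11's positivity of
the constrained gauge-fixed Hessian, a displayed TYPE statement).  Then for some `ρ > 0` there is `Fm : ComplexBackgroundFamily P Ξ R0 ρ`
(the substrate's D-8 (v) interface, built by `ofInvertible`) solving `g (ξ, Fm.uC ξ) = g (0, R0)` on `ball 0 ρ`, with the uniqueness
clause near `(0, R0)`.  The radius is NOT controlled ([I] Lemma 4's quantitative clauses stay displayed).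
[cite: Balaban1987RG1, Lemma 4 (3.53) p.280; Balaban1985Variational, Thm 1 p.279] -/
theorem exists_complexBackgroundFamily_of_implicit {R0 : TowerData P o} (hR0 : ∀ (k : Fin (P.K + 1)) ν b, IsUnit (R0 k ν b).det)
    {g : Ξ × TowerData P o → F} (hg : ContDiffAt ℂ ω g (0, R0))
    (hinv : (fderiv ℂ g (0, R0) ∘L ContinuousLinearMap.inr ℂ Ξ (TowerData P o)).IsInvertible) :
    ∃ ρ > 0, ∃ Fm : ComplexBackgroundFamily P Ξ R0 ρ,
      (∀ ξ ∈ ball (0 : Ξ) ρ, g (ξ, Fm.uC ξ) = g (0, R0)) ∧ ContinuousAt Fm.uC 0 ∧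
        ∀ᶠ q in 𝓝 ((0 : Ξ), R0), g q = g (0, R0) ↔ Fm.uC q.1 = q.2 := by
  haveI : CompleteSpace (TowerData P o) := FiniteDimensional.complete ℂ _
  obtain ⟨x, hx0, hxc, huniq, ρ₁, hρ₁, hdiff, hz⟩ := exists_ball_holomorphic_implicit hg hinv
  obtain ⟨ρ₂, hρ₂, hunit⟩ := eventually_isUnit_det_family P hxc hx0 hR0
  have hd : ∀ (k : Fin (P.K + 1)) ν b, DifferentiableOn ℂ (fun ξ => x ξ k ν b) (ball (0 : Ξ) (min ρ₁ ρ₂)) := fun k ν b =>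
    differentiableOn_pi.1 (differentiableOn_pi.1 (differentiableOn_pi.1
      (hdiff.mono (Metric.ball_subset_ball (min_le_left _ _))) k) ν) b
  have hu : ∀ ξ ∈ ball (0 : Ξ) (min ρ₁ ρ₂), ∀ (k : Fin (P.K + 1)) ν b, IsUnit (x ξ k ν b).det :=
    fun ξ hξ => hunit ξ (Metric.ball_subset_ball (min_le_right _ _) hξ)
  refine ⟨min ρ₁ ρ₂, lt_min hρ₁ hρ₂, ComplexBackgroundFamily.ofInvertible R0 (min ρ₁ ρ₂) x hx0 hd hu, ?_, hxc, huniq⟩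
  exact fun ξ hξ => hz ξ (Metric.ball_subset_ball (min_le_left _ _) hξ)

omit [CompleteSpace Ξ] [NormedAddCommGroup F] [NormedSpace ℂ F] [CompleteSpace F] in
/-- **THE REAL-SLICE TIE FOR THE FAMILY**: any family of tower data CONTINUOUS at `0`, through `R0`, solving the same equation near `0`
(in use: the real backgrounds of record along a real slice parameter) agrees with `Fm.uC` near `0` — the holomorphic family EXTENDS it.
[cite: Balaban1987RG1, (1.18) p.263] -/
theorem uC_eventuallyEq_of_zero_family {R0 : TowerData P o} {ρ : ℝ} (Fm : ComplexBackgroundFamily P Ξ R0 ρ)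
    {g : Ξ × TowerData P o → F} (huniq : ∀ᶠ q in 𝓝 ((0 : Ξ), R0), g q = g (0, R0) ↔ Fm.uC q.1 = q.2)
    {y : Ξ → TowerData P o} (hyc : ContinuousAt y 0) (hy0 : y 0 = R0) (hyz : ∀ᶠ ξ in 𝓝 (0 : Ξ), g (ξ, y ξ) = g (0, R0)) :
    y =ᶠ[𝓝 (0 : Ξ)] Fm.uC :=
  eventuallyEq_of_zero_family huniq hyc hy0 hyz

end Summit.QuantumFields.BalabanUV.T4Continuum.NE9ComplexBackgroundOfImplicit

end
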